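import Summits.KontsevichZagierPeriods.KontsevichZagierPeriods.Theses.SymplecticScissors
import Literature.NumberTheory.Transcendental.SemialgebraicMonotonicityProofs
import Literature.NumberTheory.Transcendental.SemialgebraicDerivativeProofs

/-!
# Signed sweep of the triangle, helper VII: germ types with rational coefficients

Helper file for the stub `stub_signedSweep` of the line `twist-restoring-shear` (crux
`PlanarCompiler`, route `SymplecticScissors`). The monotonicity theorem is needed with
breakpoints that are `ℚ`-semialgebraic points (the strips of the sweep must be `ℚ`-semialgebraic).
We therefore record the six one-sided germ-type sets of a function `f : ℝ → ℝ` with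
`ℚ`-semialgebraic graph (`f y <, =, > f x` just right / just left of `x`) as `ℚ`-SEMIALGEBRAIC
subsets of the line (first-order formulas with coefficients in `ℚ`, Tarski–Seidenberg), and show
that on every open interval to which these six sets are adapted, `f` is constant, strictly
increasing or strictly decreasing (van den Dries' sorting of the nine germ types, as proved in
`SemialgebraicMonotonicityProofs`). A cylindrical decomposition adapted to the six sets then has
algebraic breakpoints.
-/

noncomputable section

open MeasureTheory Set Filter Topology
open Literature.NumberTheory.Transcendental Literature.ModelTheory.ExponentialFields
open Literature.NumberTheory.Transcendental.SemialgebraicDerivative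

namespace Summit.KontsevichZagierPeriods.SymplecticScissors.PlanarCompilerProof

/-! ### First-order atoms with coefficients in `ℚ` -/

/-- The atom `w i = w j` is `ℚ`-semialgebraic. [folklore] -/
theorem sa_eq_rat {n : ℕ} (i j : Fin n) : IsSemialgebraic ℚ {w : Fin n → ℝ | w i = w j} := by
  convert (sa_ne (k := ℚ) i j).compl using 1
  ext w
  simp

/-- **Binary atom through the graph**: `r (f (w i)) (f (w j))` is `ℚ`-semialgebraic for a
`ℚ`-semialgebraic relation `r` and a function with `ℚ`-semialgebraic graph (two projections).
[cite: BochnakCosteRoy1998, Prop. 2.2.4] -/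
theorem sa_frel_rat {f : ℝ → ℝ}
    (hG : IsSemialgebraic ℚ {w : Fin 2 → ℝ | w 0 ∈ (univ : Set ℝ) ∧ w 1 = f (w 0)})
    {r : ℝ → ℝ → Prop} (hr : ∀ (m : ℕ) (i j : Fin m), IsSemialgebraic ℚ {w : Fin m → ℝ | r (w i) (w j)})
    {n : ℕ} (i j : Fin n) : IsSemialgebraic ℚ {z : Fin n → ℝ | r (f (z i)) (f (z j))} := by
  -- adapted from `SemialgebraicMonotonicity.sa_frel` (real coefficients)
  have key : IsSemialgebraic ℚ
      {z : Fin n → ℝ | ∃ u v, (z i ∈ (univ : Set ℝ) ∧ u = f (z i)) ∧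
        (z j ∈ (univ : Set ℝ) ∧ v = f (z j)) ∧ r u v} := by
    refine sa_exists (sa_exists ?_)
    exact sa_and (sa_graph₀ hG (Fin.castSucc (Fin.castSucc i)) (Fin.castSucc (Fin.last n)))
      (sa_and (sa_graph₀ hG (Fin.castSucc (Fin.castSucc j)) (Fin.last (n + 1)))
        (hr _ (Fin.castSucc (Fin.last n)) (Fin.last (n + 1))))
  convert key using 1
  ext z
  simp only [mem_setOf_eq, mem_univ, true_and]
  constructor
  · intro h
    exact ⟨f (z i), f (z j), rfl, rfl, h⟩
  · rintro ⟨u, v, rfl, rfl, h⟩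
    exact h

/-- **Right germ types are `ℚ`-semialgebraic**: `{x | r (f y) (f x) for y just right of x}` is
defined by `∃ c (x < c ∧ ∀ y (x < y < c → r (f y) (f x)))`. [cite: Dries1998, Ch. 3 (1.5)] -/
theorem sa_germ_right {f : ℝ → ℝ}
    (hG : IsSemialgebraic ℚ {w : Fin 2 → ℝ | w 0 ∈ (univ : Set ℝ) ∧ w 1 = f (w 0)})
    {r : ℝ → ℝ → Prop} (hr : ∀ (m : ℕ) (i j : Fin m), IsSemialgebraic ℚ {w : Fin m → ℝ | r (w i) (w j)}) :
    IsSemialgebraic ℚ {z : Fin 1 → ℝ | ∀ᶠ y in 𝓝[>] (z 0), r (f y) (f (z 0))} := by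
  have key : IsSemialgebraic ℚ
      {z : Fin 1 → ℝ | ∃ c, z 0 < c ∧ ∀ y, (z 0 < y ∧ y < c) → r (f y) (f (z 0))} := by
    refine sa_exists ?_
    refine sa_and (sa_lt 0 1) (sa_forall ?_)
    exact sa_imp (sa_and (sa_lt 0 2) (sa_lt 2 1)) (sa_frel_rat hG hr 2 0)
  convert key using 1
  ext z
  simp only [mem_setOf_eq]
  constructor
  · intro h
    obtain ⟨c, hc, hsub⟩ := mem_nhdsGT_iff_exists_Ioo_subset.1 h
    exact ⟨c, hc, fun y hy => hsub hy⟩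
  · rintro ⟨c, hc, h⟩
    exact mem_nhdsGT_iff_exists_Ioo_subset.2 ⟨c, hc, fun y hy => h y hy⟩

/-- **Left germ types are `ℚ`-semialgebraic** (mirror image). [cite: Dries1998, Ch. 3 (1.5)] -/
theorem sa_germ_left {f : ℝ → ℝ}
    (hG : IsSemialgebraic ℚ {w : Fin 2 → ℝ | w 0 ∈ (univ : Set ℝ) ∧ w 1 = f (w 0)})
    {r : ℝ → ℝ → Prop} (hr : ∀ (m : ℕ) (i j : Fin m), IsSemialgebraic ℚ {w : Fin m → ℝ | r (w i) (w j)}) :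
    IsSemialgebraic ℚ {z : Fin 1 → ℝ | ∀ᶠ y in 𝓝[<] (z 0), r (f y) (f (z 0))} := by
  have key : IsSemialgebraic ℚ
      {z : Fin 1 → ℝ | ∃ c, c < z 0 ∧ ∀ y, (c < y ∧ y < z 0) → r (f y) (f (z 0))} := by
    refine sa_exists ?_
    refine sa_and (sa_lt 1 0) (sa_forall ?_)
    exact sa_imp (sa_and (sa_lt 1 2) (sa_lt 2 0)) (sa_frel_rat hG hr 2 0)
  convert key using 1
  ext z
  simp only [mem_setOf_eq]
  constructor
  · intro h
    obtain ⟨c, hc, hsub⟩ := mem_nhdsLT_iff_exists_Ioo_subset.1 h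
    exact ⟨c, hc, fun y hy => hsub hy⟩
  · rintro ⟨c, hc, h⟩
    exact mem_nhdsLT_iff_exists_Ioo_subset.2 ⟨c, hc, fun y hy => h y hy⟩

/-! ### The germ family and monotonicity on adapted intervals -/

/-- **Germ family.** For `f : ℝ → ℝ` with `ℚ`-semialgebraic graph there is a finite family of
`ℚ`-semialgebraic subsets of the line (the six one-sided germ-type sets) such that on every open
interval to which the family is adapted (each member contains the interval or misses it), `f` is
constant, strictly increasing or strictly decreasing (sorting the nine germ types,
[Dries1998, Ch. 3 (1.4)–(1.5)]). [cite: Dries1998, Ch. 3 (1.2)] -/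
theorem stub_signedSweep_germFamily :
    ∀ (f : ℝ → ℝ), IsSemialgebraicFunOn ℚ (univ : Set (Fin 1 → ℝ)) (fun z => f (z 0)) →
    ∃ 𝒢 : Finset (Set (Fin 1 → ℝ)), (∀ G ∈ 𝒢, IsSemialgebraic ℚ G) ∧
      ∀ u v : ℝ, u < v →
        (∀ G ∈ 𝒢, {z : Fin 1 → ℝ | z 0 ∈ Ioo u v} ⊆ G ∨ Disjoint {z : Fin 1 → ℝ | z 0 ∈ Ioo u v} G) →
        (∃ c, EqOn f (fun _ => c) (Ioo u v)) ∨ StrictMonoOn f (Ioo u v) ∨ StrictAntiOn f (Ioo u v) := by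
  intro f hf
  classical
  have hG : IsSemialgebraic ℚ {w : Fin 2 → ℝ | w 0 ∈ (univ : Set ℝ) ∧ w 1 = f (w 0)} := by
    have h := isSemialgebraicFunOn_iff.mp hf
    convert h using 1
    ext w
    simp only [mem_univ, true_and, mem_setOf_eq]
    rfl
  have hlt : ∀ (m : ℕ) (i j : Fin m), IsSemialgebraic ℚ {w : Fin m → ℝ | w i < w j} :=
    fun m i j => sa_lt i j
  have hgt : ∀ (m : ℕ) (i j : Fin m), IsSemialgebraic ℚ {w : Fin m → ℝ | w j < w i} :=
    fun m i j => sa_lt j i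
  have heq : ∀ (m : ℕ) (i j : Fin m), IsSemialgebraic ℚ {w : Fin m → ℝ | w i = w j} :=
    fun m i j => sa_eq_rat i j
  set R₁ : Set (Fin 1 → ℝ) := {z | ∀ᶠ y in 𝓝[>] (z 0), f y < f (z 0)} with hR₁
  set R₂ : Set (Fin 1 → ℝ) := {z | ∀ᶠ y in 𝓝[>] (z 0), f y = f (z 0)} with hR₂
  set R₃ : Set (Fin 1 → ℝ) := {z | ∀ᶠ y in 𝓝[>] (z 0), f (z 0) < f y} with hR₃
  set L₁ : Set (Fin 1 → ℝ) := {z | ∀ᶠ y in 𝓝[<] (z 0), f y < f (z 0)} with hL₁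
  set L₂ : Set (Fin 1 → ℝ) := {z | ∀ᶠ y in 𝓝[<] (z 0), f y = f (z 0)} with hL₂
  set L₃ : Set (Fin 1 → ℝ) := {z | ∀ᶠ y in 𝓝[<] (z 0), f (z 0) < f y} with hL₃
  have hR₁sa : IsSemialgebraic ℚ R₁ := sa_germ_right hG (r := fun a b => a < b) hlt
  have hR₂sa : IsSemialgebraic ℚ R₂ := sa_germ_right hG (r := fun a b => a = b) heq
  have hR₃sa : IsSemialgebraic ℚ R₃ := sa_germ_right hG (r := fun a b => b < a) hgt
  have hL₁sa : IsSemialgebraic ℚ L₁ := sa_germ_left hG (r := fun a b => a < b) hlt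
  have hL₂sa : IsSemialgebraic ℚ L₂ := sa_germ_left hG (r := fun a b => a = b) heq
  have hL₃sa : IsSemialgebraic ℚ L₃ := sa_germ_left hG (r := fun a b => b < a) hgt
  refine ⟨{R₁, R₂, R₃, L₁, L₂, L₃}, ?_, ?_⟩
  · intro G hGm
    simp only [Finset.mem_insert, Finset.mem_singleton] at hGm
    rcases hGm with rfl | rfl | rfl | rfl | rfl | rfl <;> assumption
  · intro u v huv had
    -- the real-semialgebraic graph over `(u, v)`, for the germ trichotomies
    have hGr : IsSemialgebraic ℝ {w : Fin 2 → ℝ | w 0 ∈ Ioo u v ∧ w 1 = f (w 0)} := by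
      have h1 := (SemialgebraicMonotonicity.sa_mem_Ioo (n := 2) 0 u v).inter
        (SemialgebraicMonotonicity.isSemialgebraic_real_of hG)
      convert h1 using 1
      ext w
      simp only [mem_setOf_eq, mem_inter_iff, mem_univ, true_and]
    -- a germ set containing one point of the strip contains the strip
    have spread : ∀ G ∈ ({R₁, R₂, R₃, L₁, L₂, L₃} : Finset (Set (Fin 1 → ℝ))), ∀ x ∈ Ioo u v,
        ((fun _ => x : Fin 1 → ℝ)) ∈ G → ∀ y ∈ Ioo u v, ((fun _ => y : Fin 1 → ℝ)) ∈ G := by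
      intro G hGm x hx hxG y hy
      rcases had G hGm with h | h
      · exact h (show ((fun _ => y : Fin 1 → ℝ)) ∈ {z : Fin 1 → ℝ | z 0 ∈ Ioo u v} from hy)
      · exact absurd hxG (Set.disjoint_left.1 h (show ((fun _ => x : Fin 1 → ℝ)) ∈
          {z : Fin 1 → ℝ | z 0 ∈ Ioo u v} from hx))
    have hm : (u + v) / 2 ∈ Ioo u v := ⟨by linarith, by linarith⟩
    -- right type on the strip
    have hR : (∀ x ∈ Ioo u v, ∀ᶠ y in 𝓝[>] x, f y < f x) ∨ (∀ x ∈ Ioo u v, ∀ᶠ y in 𝓝[>] x, f y = f x) ∨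
        (∀ x ∈ Ioo u v, ∀ᶠ y in 𝓝[>] x, f x < f y) := by
      rcases SemialgebraicMonotonicity.germ_right hGr hm with h | h | h
      · exact Or.inl fun x hx => spread R₁ (by simp) _ hm h x hx
      · exact Or.inr (Or.inl fun x hx => spread R₂ (by simp) _ hm h x hx)
      · exact Or.inr (Or.inr fun x hx => spread R₃ (by simp) _ hm h x hx)
    have hL : (∀ x ∈ Ioo u v, ∀ᶠ y in 𝓝[<] x, f y < f x) ∨ (∀ x ∈ Ioo u v, ∀ᶠ y in 𝓝[<] x, f y = f x) ∨
        (∀ x ∈ Ioo u v, ∀ᶠ y in 𝓝[<] x, f x < f y) := by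
      rcases SemialgebraicMonotonicity.germ_left hGr hm with h | h | h
      · exact Or.inl fun x hx => spread L₁ (by simp) _ hm h x hx
      · exact Or.inr (Or.inl fun x hx => spread L₂ (by simp) _ hm h x hx)
      · exact Or.inr (Or.inr fun x hx => spread L₃ (by simp) _ hm h x hx)
    -- sorting the nine types
    rcases hR with r1 | r2 | r3 <;> rcases hL with l1 | l2 | l3
    · exact (SemialgebraicMonotonicity.not_forall_isStrictLocalMin (f := fun x => -f x) huv
        fun x hx => SemialgebraicMonotonicity.eventually_nhdsNE_of_LT_GT
          ((l1 x hx).mono fun y hy => neg_lt_neg hy) ((r1 x hx).mono fun y hy => neg_lt_neg hy)).elim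
    · exact (SemialgebraicMonotonicity.not_Ioo_subset_eventuallyEq_left huv
        fun x hx => ⟨l2 x hx, Or.inl (r1 x hx)⟩).elim
    · exact Or.inr (Or.inr (SemialgebraicMonotonicity.strictAntiOn_of_eventually
        fun x hx => ⟨l3 x hx, r1 x hx⟩))
    · exact (SemialgebraicMonotonicity.not_Ioo_subset_eventuallyEq_right huv
        fun x hx => ⟨r2 x hx, Or.inl (l1 x hx)⟩).elim
    · exact Or.inl (SemialgebraicMonotonicity.exists_eqOn_const_of_eventually huv
        fun x hx => ⟨l2 x hx, r2 x hx⟩)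
    · exact (SemialgebraicMonotonicity.not_Ioo_subset_eventuallyEq_right huv
        fun x hx => ⟨r2 x hx, Or.inr (l3 x hx)⟩).elim
    · exact Or.inr (Or.inl (SemialgebraicMonotonicity.strictMonoOn_of_eventually
        fun x hx => ⟨l1 x hx, r3 x hx⟩))
    · exact (SemialgebraicMonotonicity.not_Ioo_subset_eventuallyEq_left huv
        fun x hx => ⟨l2 x hx, Or.inr (r3 x hx)⟩).elim
    · exact (SemialgebraicMonotonicity.not_forall_isStrictLocalMin huv
        fun x hx => SemialgebraicMonotonicity.eventually_nhdsNE_of_LT_GT (l3 x hx) (r3 x hx)).elim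

end Summit.KontsevichZagierPeriods.SymplecticScissors.PlanarCompilerProof
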